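/-
Copyright: the b2b-balaban T⁴-continuum CRUX team, row NE7b OWNER lineage `t4-ne7b-p1` (gen 122). Project licence.
-/
import Summits.QuantumFields.BalabanUV.T4Continuum.Spine.NE7b.SupTorusPerturbedResponse
import Summits.QuantumFields.BalabanUV.T4Continuum.Spine.NE7b.SupTorusCovarianceLocality

/-!
# THE FLUCTUATION COVARIANCE `C_K = (H+K)⁻¹ − (H+K)⁻¹Q′t*T_K⁻¹Q′t(H+K)⁻¹` OF THE PERTURBED ROAD IS EXPONENTIALLY LOCAL BLOCK-TO-BLOCK
# IN `ℓ²`, UNCONDITIONALLY on the two-sided class — (139) `covariance_local` RE-RUN for `H + K`: a source `f` in ONE block `y₀`,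
# `(H + K)u = f` ⟹ `Σ_{B_y}u² ≤ Ce^{−2δρ_s(y,y₀)}Σf²`, the fluctuation part `u − h` (`h = Σ_{y′}(T_K⁻¹Q′tu)(y′)ψ^K_{y′}`) has ZERO block
# means and `Σ_{B_y}(u − h)² ≤ Ce^{−2δρ_s(y,y₀)}Σf²` — `(C, δ)` from `(d, a, λ, Λ, ε, γ)` ONLY (row NE7b, node U5c; (138)∕(139)∕(164)∕(166)–(168)
# BY NAME; [folklore])

Cell `pub-balaban`, sub-cell `t4`, spine estimate NE7b (`T4WeightBudget.RelWeightBound`; the cell's OWN estimate — NOT PRINTED in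
[Bałaban 1983–89], NOT PROVED).  Crux-route work under `Spine/NE7b/` by the row OWNER (`t4-ne7b-p1` gen 122, file (169)) under FREEZE
(0)'s crux-prover clause; NOTHING of Bałaban's is named as a Lean object, valued or asserted; no `T4Continuum/Support` leaf typed; no `def`,
no notation; zero `sorry`.  Imports (BY NAME): the OWNER's (168) `…SupTorusPerturbedResponse` (`kernelSum_anti`,
`perturbed_superposition_equation`, `perturbed_schur_mulVec_injective`; through it (167) `perturbed_blockSq_le_of_decaying_source`, (166)
`perturbed_nextScale_hessian_local`, (164) `perturbed_blockSq_le_of_block_source`, (137) `rate_mono`, (131) `exists_rate`), (139)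
`…SupTorusCovarianceLocality` (`blockMean_response_eq`; through it (138) `coarse_convolution_le`).

WHY (located).  (139) is the covariance of the Gaussian part of the fluctuation integral at a background with Hessian `H`; along the
road the Hessian is `H + K` with `K` a small exponentially local symmetric kernel ((102)∕(135)∕(166)), and every ingredient of (139) has
been re-run for `H + K`: block locality of `(H + K)⁻¹` ((164)), decay of `T_K⁻¹` ((166)), the block-profile source lemma ((167)),
invertibility of `T_K` and the superposition display ((168)).  This file is (139)'s assembly word for word with the kernel sum subtracted
from the floors; the only new letter is the coarse read-out bound (§1, block Cauchy–Schwarz on (164)).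

WHAT IS PROVED ([folklore]; fine torus `Site d ((n+1)s)`, coarse `Site d s`; `(H + K)u` DISPLAYED; `m_κ = min(2,a) − λ − 2dκ² − a(e^{2dκ} − 1)`,
`K_α = (2∕(1 − e^{−α}))^d`; `c y′ = Σ_{y″}M y′ y″·(n+1)^{−d}Σ_z u(σ(chart (wm y″) z))`, `h = Σ_{y′}c y′·ψ^K_{y′}`, columns `(H + K)ψ^K_{y′} = 𝟙[bt · = y′]`):
* §1 **`perturbed_blockMean_le_of_block_source`** (`f` in the block `y₀`, `(H + K)u = f` ⟹ `|(n+1)^{−d}Σ_z u(σ(chart (wm y) z))| ≤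
  (m_κ − εK_{γ−κ})⁻¹e^{2dκ}√((n+1)^{−d}Σf²)·e^{−κρ_s(y,y₀)}`).
* §2 **`perturbed_coeff_le`**, **`perturbed_response_blockSq_le`**, **`perturbed_fluctuation_blockSq_le`** ((139) §1 for `H + K`).
* §3 **`perturbed_covariance_local`** (HEADLINE; `a > 0`, `λ < min(2,a)`, `Λ ≥ 0`, `ε ≥ 0`, `γ > 1`, `εK_{γ−1} ≤ (min(2,a) − λ)∕4`): THERE
  ARE `C, δ > 0` such that for ALL `n, s`, ALL `−λ ≤ V ≤ Λ`, ALL symmetric `|K| ≤ εe^{−γρ_N}` with block columns `ψ^K`, every block `y₀`,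
  every `(H + K)u = f` with `f` in the block `y₀`, `M = T_K⁻¹`: (i) `Σ_z u(σ(chart (wm y) z))² ≤ Ce^{−2δρ_s(y,y₀)}Σf²`; (ii) `(n+1)^{−d}Σ_z
  (u − h)(σ(chart (wm y) z)) = 0`; (iii) `Σ_z (u − h)(σ(chart (wm y) z))² ≤ Ce^{−2δρ_s(y,y₀)}Σf²` — every block `y`.
* §4 toy.

HONEST (what this is NOT).  Block-`ℓ²` currency, sources in one block; not pointwise; the identification of `u − h` with the road's
fluctuation covariance is by the displays (`Q′t(u − h) = 0`, `(H + K)(u − h) = f − c∘bt`); constants explicit, far from sharp; cubic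
periods; scalar skeleton ((A3), NC-NE7b-α UNRULED); nothing of Bałaban's.  BY-NAME EFFECT ON THE WALL: NONE.  NE7b NOT PRINTED ∕ NOT
PROVED; spine PROVED 0∕9; rung (B)+1 on a FINITE torus — NOT infinite volume, NOT the mass gap, NOT Clay.  HONEST DEPENDENCY: continuum
YM on T⁴ ⇐ BetaPertH ∧ nine spine estimates (0∕9 proved); BetaPertH ⇐ (D1) ∧ (D4) ∧ CAP+tail; G-an2-4 gates asym, D1 and NE2∕3∕4.
-/

set_option autoImplicit false

noncomputable section

namespace Summit.QuantumFields.BalabanUV.T4Continuum.NE7b.SupTorusPerturbedCovariance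

open Real
open Literature.MathematicalPhysics.QuantumFieldTheory.Balaban1983to89
open B6QGQLower276 (X e blk B side chart mem_B sum_B sum_B_const card_cube blk_chart)
open Beta (Site siteOf windowMap siteOf_windowMap siteOf_add)
open SupTorusHessianCombesThomas (exists_rate)
open SupTorusResponseLocality (rate_mono)
open SupTorusPropagatorLocality (coarse_convolution_le)
open SupTorusCovarianceLocality (blockMean_response_eq)
open SupTorusPerturbedLocality (perturbed_blockSq_le_of_block_source)
open SupTorusPerturbedCoarseFloor (perturbed_nextScale_hessian_local)
open SupTorusPerturbedProfile (perturbed_blockSq_le_of_decaying_source)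
open SupTorusPerturbedResponse (kernelSum_anti perturbed_superposition_equation perturbed_schur_mulVec_injective)

variable {d : ℕ}

/-! ## §1. The coarse read-out `Q′t(H + K)⁻¹` of a block source decays -/

section Block

variable (n : ℕ) (a : ℝ) (s : ℕ) [NeZero s] (ha : 0 ≤ a) {lam κ ε γ : ℝ} (hκ0 : 0 ≤ κ) (hκ1 : κ ≤ 1) (hκγ : κ < γ) (hε : 0 ≤ ε)
  (hm : ε * (2 * (1 - exp (-(γ - κ)))⁻¹) ^ d < min 2 a - lam - 2 * d * κ ^ 2 - a * (exp (2 * d * κ) - 1))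
  (V : Site d ((n + 1) * s) → ℝ) (hV : ∀ x, -lam ≤ V x)
  (K : Site d ((n + 1) * s) → Site d ((n + 1) * s) → ℝ)
  (hK : ∀ x z, |K x z| ≤ ε * exp (-(γ * ∑ i, (((x i - z i).valMinAbs.natAbs : ℕ) : ℝ))))
  (y₀ : Site d s) (u f : Site d ((n + 1) * s) → ℝ)
  (hf : ∀ x, siteOf d s (blk n (windowMap d ((n + 1) * s) x)) ≠ y₀ → f x = 0)
  (hu : ∀ x, ((n : ℝ) + 1) ^ 2 * ∑ μ, (2 * u x - u (x + siteOf d ((n + 1) * s) (e μ)) - u (x - siteOf d ((n + 1) * s) (e μ)))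
      + a / ((n : ℝ) + 1) ^ d * ∑ q ∈ B n (blk n (windowMap d ((n + 1) * s) x)), u (siteOf d ((n + 1) * s) q) + V x * u x
      + ∑ z, K x z * u z = f x)

include ha hκ0 hκ1 hκγ hε hm hV hK hf hu in
/-- **THE COARSE READ-OUT `Q′t(H + K)⁻¹` OF A BLOCK SOURCE DECAYS**: `|(n+1)^{−d}Σ_z u(σ(chart (wm y) z))| ≤ (m_κ − εK_{γ−κ})⁻¹e^{2dκ}·
√((n+1)^{−d}Σ_x f x²)·e^{−κρ_s(y,y₀)}` (block Cauchy–Schwarz on (164) `perturbed_blockSq_le_of_block_source`; (138)'s reading). [folklore] -/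
theorem perturbed_blockMean_le_of_block_source (y : Site d s) :
    |(((n : ℝ) + 1) ^ d)⁻¹ * ∑ z : Fin d → Fin (n + 1), u (siteOf d ((n + 1) * s) (chart n (windowMap d s y) z))|
      ≤ (min 2 a - lam - 2 * d * κ ^ 2 - a * (exp (2 * d * κ) - 1) - ε * (2 * (1 - exp (-(γ - κ)))⁻¹) ^ d)⁻¹ * exp (2 * d * κ)
          * √((((n : ℝ) + 1) ^ d)⁻¹ * ∑ x, f x ^ 2)
        * exp (-(κ * ∑ i, (((y i - y₀ i).valMinAbs.natAbs : ℕ) : ℝ))) := by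
  classical
  set m := min 2 a - lam - 2 * d * κ ^ 2 - a * (exp (2 * d * κ) - 1) - ε * (2 * (1 - exp (-(γ - κ)))⁻¹) ^ d with hm_def
  have hm0 : 0 < m := by rw [hm_def]; linarith
  have hvol : (0 : ℝ) < ((n : ℝ) + 1) ^ d := by positivity
  have hblock := perturbed_blockSq_le_of_block_source n a s ha hκ0 hκ1 hκγ hε hm V hV K hK u f hu y₀ hf y
  have hCS := sq_sum_le_card_mul_sum_sq (s := (Finset.univ : Finset (Fin d → Fin (n + 1))))
    (f := fun z => u (siteOf d ((n + 1) * s) (chart n (windowMap d s y) z)))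
  rw [Finset.card_univ, card_cube] at hCS
  have hF : 0 ≤ ∑ x, f x ^ 2 := Finset.sum_nonneg fun _ _ => sq_nonneg _
  have hR : 0 ≤ m⁻¹ * exp (2 * d * κ) * √((((n : ℝ) + 1) ^ d)⁻¹ * ∑ x, f x ^ 2)
      * exp (-(κ * ∑ i, (((y i - y₀ i).valMinAbs.natAbs : ℕ) : ℝ))) := by
    have : 0 ≤ m⁻¹ := inv_nonneg.2 hm0.le
    positivity
  have hsq : ((((n : ℝ) + 1) ^ d)⁻¹ * ∑ z : Fin d → Fin (n + 1), u (siteOf d ((n + 1) * s) (chart n (windowMap d s y) z))) ^ 2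
      ≤ (m⁻¹ * exp (2 * d * κ) * √((((n : ℝ) + 1) ^ d)⁻¹ * ∑ x, f x ^ 2)
          * exp (-(κ * ∑ i, (((y i - y₀ i).valMinAbs.natAbs : ℕ) : ℝ)))) ^ 2 := by
    have h4 : exp (4 * d * κ) = exp (2 * d * κ) ^ 2 := by rw [sq, ← exp_add]; ring_nf
    have h5 : exp (-(2 * κ * ∑ i, (((y i - y₀ i).valMinAbs.natAbs : ℕ) : ℝ)))
        = exp (-(κ * ∑ i, (((y i - y₀ i).valMinAbs.natAbs : ℕ) : ℝ))) ^ 2 := by rw [sq, ← exp_add]; ring_nf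
    have hroot : √((((n : ℝ) + 1) ^ d)⁻¹ * ∑ x, f x ^ 2) ^ 2 = (((n : ℝ) + 1) ^ d)⁻¹ * ∑ x, f x ^ 2 :=
      Real.sq_sqrt (mul_nonneg (inv_nonneg.2 hvol.le) hF)
    calc ((((n : ℝ) + 1) ^ d)⁻¹ * ∑ z : Fin d → Fin (n + 1), u (siteOf d ((n + 1) * s) (chart n (windowMap d s y) z))) ^ 2
        = (((n : ℝ) + 1) ^ d)⁻¹ ^ 2 * (∑ z : Fin d → Fin (n + 1), u (siteOf d ((n + 1) * s) (chart n (windowMap d s y) z))) ^ 2 := by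
          rw [mul_pow]
      _ ≤ (((n : ℝ) + 1) ^ d)⁻¹ ^ 2 * (((n : ℝ) + 1) ^ d
          * ∑ z : Fin d → Fin (n + 1), u (siteOf d ((n + 1) * s) (chart n (windowMap d s y) z)) ^ 2) :=
          mul_le_mul_of_nonneg_left hCS (sq_nonneg _)
      _ = (((n : ℝ) + 1) ^ d)⁻¹ * ∑ z : Fin d → Fin (n + 1), u (siteOf d ((n + 1) * s) (chart n (windowMap d s y) z)) ^ 2 := by
          field_simp
      _ ≤ (((n : ℝ) + 1) ^ d)⁻¹ * ((m⁻¹) ^ 2 * exp (4 * d * κ)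
          * exp (-(2 * κ * ∑ i, (((y i - y₀ i).valMinAbs.natAbs : ℕ) : ℝ))) * ∑ x, f x ^ 2) :=
          mul_le_mul_of_nonneg_left hblock (inv_nonneg.2 hvol.le)
      _ = _ := by rw [mul_pow, mul_pow, mul_pow, hroot, h4, h5]; ring
  exact abs_le.2 (abs_le_of_sq_le_sq' hsq hR)

end Block

/-! ## §2. The response part and the fluctuation part of `u = (H + K)⁻¹f`, `f` in one block -/

section Fluctuation

variable (n : ℕ) (a : ℝ) (s : ℕ) [NeZero s] (V : Site d ((n + 1) * s) → ℝ) (K : Site d ((n + 1) * s) → Site d ((n + 1) * s) → ℝ)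
  (ψ : Site d s → Site d ((n + 1) * s) → ℝ)
  (hψ : ∀ y' x, ((n : ℝ) + 1) ^ 2 * ∑ μ, (2 * ψ y' x - ψ y' (x + siteOf d ((n + 1) * s) (e μ)) - ψ y' (x - siteOf d ((n + 1) * s) (e μ)))
      + a / ((n : ℝ) + 1) ^ d * ∑ q ∈ B n (blk n (windowMap d ((n + 1) * s) x)), ψ y' (siteOf d ((n + 1) * s) q) + V x * ψ y' x
      + ∑ z, K x z * ψ y' z = if siteOf d s (blk n (windowMap d ((n + 1) * s) x)) = y' then 1 else 0)
  (Minv : Site d s → Site d s → ℝ) (u : Site d ((n + 1) * s) → ℝ)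
  (ha : 0 ≤ a) {lam κ κ' δ δ₁ c₁ ε γ : ℝ} (hκ0 : 0 ≤ κ) (hκ1 : κ ≤ 1) (hκγ : κ < γ) (hε : 0 ≤ ε)
  (hm : ε * (2 * (1 - exp (-(γ - κ)))⁻¹) ^ d < min 2 a - lam - 2 * d * κ ^ 2 - a * (exp (2 * d * κ) - 1))
  (hκ'0 : 0 < κ') (hκ'1 : κ' ≤ 1) (hκ'γ : κ' < γ)
  (hm' : ε * (2 * (1 - exp (-(γ - κ')))⁻¹) ^ d < min 2 a - lam - 2 * d * κ' ^ 2 - a * (exp (2 * d * κ') - 1))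
  (hδ : 0 < δ) (hδ₁ : δ ≤ δ₁) (h2δ : 2 * δ ≤ κ) (h2κ' : 2 * κ' ≤ δ) (hc₁ : 0 ≤ c₁)
  (hV : ∀ x, -lam ≤ V x)
  (hK : ∀ x z, |K x z| ≤ ε * exp (-(γ * ∑ i, (((x i - z i).valMinAbs.natAbs : ℕ) : ℝ))))
  (hMinv : ∀ y' y'' : Site d s, |Minv y' y''| ≤ c₁ * exp (-(δ₁ * ∑ i, (((y' i - y'' i).valMinAbs.natAbs : ℕ) : ℝ))))
  (y₀ : Site d s) (f : Site d ((n + 1) * s) → ℝ)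
  (hf : ∀ x, siteOf d s (blk n (windowMap d ((n + 1) * s) x)) ≠ y₀ → f x = 0)
  (hu : ∀ x, ((n : ℝ) + 1) ^ 2 * ∑ μ, (2 * u x - u (x + siteOf d ((n + 1) * s) (e μ)) - u (x - siteOf d ((n + 1) * s) (e μ)))
      + a / ((n : ℝ) + 1) ^ d * ∑ q ∈ B n (blk n (windowMap d ((n + 1) * s) x)), u (siteOf d ((n + 1) * s) q) + V x * u x
      + ∑ z, K x z * u z = f x)

include ha hκ0 hκ1 hκγ hε hm hδ hδ₁ h2δ hc₁ hV hK hMinv hf hu in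
/-- **THE COARSE COEFFICIENTS `c = M(Q′tu)` DECAY**: `|M y′ y″| ≤ c₁e^{−δ₁ρ_s(y′,y″)}`, `(H + K)u = f` with `f` in the block `y₀`, `δ ≤ δ₁`,
`2δ ≤ κ` ⟹ `|c y′| ≤ c₁·((m_κ − εK_{γ−κ})⁻¹e^{2dκ}√((n+1)^{−d}Σf²))·K_δ·e^{−δρ_s(y′,y₀)}` (§1 ⊛ (138) `coarse_convolution_le`). [folklore] -/
theorem perturbed_coeff_le (y' : Site d s) :
    |∑ y'', Minv y' y'' * ((((n : ℝ) + 1) ^ d)⁻¹ * ∑ z'' : Fin d → Fin (n + 1), u (siteOf d ((n + 1) * s) (chart n (windowMap d s y'') z'')))|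
      ≤ c₁ * ((min 2 a - lam - 2 * d * κ ^ 2 - a * (exp (2 * d * κ) - 1) - ε * (2 * (1 - exp (-(γ - κ)))⁻¹) ^ d)⁻¹ * exp (2 * d * κ)
            * √((((n : ℝ) + 1) ^ d)⁻¹ * ∑ x, f x ^ 2))
          * (2 * (1 - exp (-δ))⁻¹) ^ d * exp (-(δ * ∑ i, (((y' i - y₀ i).valMinAbs.natAbs : ℕ) : ℝ))) := by
  have hB : 0 ≤ (min 2 a - lam - 2 * d * κ ^ 2 - a * (exp (2 * d * κ) - 1) - ε * (2 * (1 - exp (-(γ - κ)))⁻¹) ^ d)⁻¹ * exp (2 * d * κ)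
      * √((((n : ℝ) + 1) ^ d)⁻¹ * ∑ x, f x ^ 2) := by
    have : 0 ≤ (min 2 a - lam - 2 * d * κ ^ 2 - a * (exp (2 * d * κ) - 1) - ε * (2 * (1 - exp (-(γ - κ)))⁻¹) ^ d)⁻¹ :=
      inv_nonneg.2 (by linarith)
    positivity
  exact coarse_convolution_le s hδ hδ₁ h2δ hc₁ hB y' y₀ (fun y'' => Minv y' y'')
    (fun y'' => (((n : ℝ) + 1) ^ d)⁻¹ * ∑ z'' : Fin d → Fin (n + 1), u (siteOf d ((n + 1) * s) (chart n (windowMap d s y'') z'')))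
    (fun y'' => hMinv y' y'') (fun y'' => perturbed_blockMean_le_of_block_source n a s ha hκ0 hκ1 hκγ hε hm V hV K hK y₀ u f hf hu y'')

include ha hκ0 hκ1 hκγ hε hm hκ'0 hκ'1 hκ'γ hm' hδ hδ₁ h2δ h2κ' hc₁ hV hK hψ hMinv hf hu in
/-- **THE RESPONSE PART IS EXPONENTIALLY LOCAL IN BLOCK `ℓ²`, MESH-FREE**: with `c = M(Q′tu)` and `h = Σ_{y′}c y′·ψ^K_{y′}` (so `(H + K)h =
c∘bt`), for every block `y`: `Σ_z h(σ(chart (wm y) z))² ≤ (m_{κ′} − εK_{γ−κ′})⁻²(m_κ − εK_{γ−κ})⁻²c₁²e^{4dκ}e^{4dκ′}K_δ²K_{2κ′}·e^{−2κ′ρ_s(y,y₀)}·Σ_x f x²`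
— (167) `perturbed_blockSq_le_of_decaying_source` on `perturbed_coeff_le`; the block volume cancels the block-RMS source size EXACTLY. [folklore] -/
theorem perturbed_response_blockSq_le (y : Site d s) :
    ∑ z : Fin d → Fin (n + 1), (∑ y', (∑ y'', Minv y' y''
        * ((((n : ℝ) + 1) ^ d)⁻¹ * ∑ z'' : Fin d → Fin (n + 1), u (siteOf d ((n + 1) * s) (chart n (windowMap d s y'') z''))))
        * ψ y' (siteOf d ((n + 1) * s) (chart n (windowMap d s y) z))) ^ 2
      ≤ ((min 2 a - lam - 2 * d * κ' ^ 2 - a * (exp (2 * d * κ') - 1) - ε * (2 * (1 - exp (-(γ - κ')))⁻¹) ^ d)⁻¹) ^ 2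
          * ((min 2 a - lam - 2 * d * κ ^ 2 - a * (exp (2 * d * κ) - 1) - ε * (2 * (1 - exp (-(γ - κ)))⁻¹) ^ d)⁻¹) ^ 2
          * c₁ ^ 2 * exp (4 * d * κ) * exp (4 * d * κ') * ((2 * (1 - exp (-δ))⁻¹) ^ d) ^ 2 * (2 * (1 - exp (-(2 * κ')))⁻¹) ^ d
        * exp (-(2 * κ' * ∑ i, (((y i - y₀ i).valMinAbs.natAbs : ℕ) : ℝ))) * ∑ x, f x ^ 2 := by
  classical
  set m := min 2 a - lam - 2 * d * κ ^ 2 - a * (exp (2 * d * κ) - 1) - ε * (2 * (1 - exp (-(γ - κ)))⁻¹) ^ d with hm_def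
  set m' := min 2 a - lam - 2 * d * κ' ^ 2 - a * (exp (2 * d * κ') - 1) - ε * (2 * (1 - exp (-(γ - κ')))⁻¹) ^ d with hm'_def
  set Kδ : ℝ := (2 * (1 - exp (-δ))⁻¹) ^ d with hKδ
  set K2 : ℝ := (2 * (1 - exp (-(2 * κ')))⁻¹) ^ d with hK2
  set M : ℝ := m⁻¹ * exp (2 * d * κ) * √((((n : ℝ) + 1) ^ d)⁻¹ * ∑ x, f x ^ 2) with hM
  set c : Site d s → ℝ := fun y' => ∑ y'', Minv y' y''
    * ((((n : ℝ) + 1) ^ d)⁻¹ * ∑ z'' : Fin d → Fin (n + 1), u (siteOf d ((n + 1) * s) (chart n (windowMap d s y'') z''))) with hc_def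
  have hvol : (0 : ℝ) < ((n : ℝ) + 1) ^ d := by positivity
  have hF : 0 ≤ ∑ x, f x ^ 2 := Finset.sum_nonneg fun _ _ => sq_nonneg _
  have hcoef : ∀ y', |c y'| ≤ c₁ * M * Kδ * exp (-(δ * ∑ i, (((y' i - y₀ i).valMinAbs.natAbs : ℕ) : ℝ))) :=
    fun y' => perturbed_coeff_le n a s V K Minv u ha hκ0 hκ1 hκγ hε hm hδ hδ₁ h2δ hc₁ hV hK hMinv y₀ f hf hu y'
  have hH : ∀ x, ((n : ℝ) + 1) ^ 2 * ∑ μ, (2 * (∑ y', c y' * ψ y' x) - (∑ y', c y' * ψ y' (x + siteOf d ((n + 1) * s) (e μ)))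
        - (∑ y', c y' * ψ y' (x - siteOf d ((n + 1) * s) (e μ))))
      + a / ((n : ℝ) + 1) ^ d * ∑ q ∈ B n (blk n (windowMap d ((n + 1) * s) x)), (∑ y', c y' * ψ y' (siteOf d ((n + 1) * s) q))
      + V x * (∑ y', c y' * ψ y' x) + ∑ z, K x z * (∑ y', c y' * ψ y' z) = c (siteOf d s (blk n (windowMap d ((n + 1) * s) x))) :=
    fun x => perturbed_superposition_equation n a s V K ψ hψ c x
  have h167 := perturbed_blockSq_le_of_decaying_source n a s ha hκ'0 hκ'1 hκ'γ hε hm' h2κ' V hV K hK y₀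
    (fun x => ∑ y', c y' * ψ y' x) (fun x => c (siteOf d s (blk n (windowMap d ((n + 1) * s) x)))) hH c hcoef (fun _ => rfl) y
  refine h167.trans (le_of_eq ?_)
  -- `(n+1)^d(c₁MK_δ)² = c₁²K_δ²m⁻²e^{4dκ}Σf²`
  have hM2 : ((n : ℝ) + 1) ^ d * (c₁ * M * Kδ) ^ 2 = c₁ ^ 2 * Kδ ^ 2 * (m⁻¹) ^ 2 * exp (4 * d * κ) * ∑ x, f x ^ 2 := by
    have hroot : √((((n : ℝ) + 1) ^ d)⁻¹ * ∑ x, f x ^ 2) ^ 2 = (((n : ℝ) + 1) ^ d)⁻¹ * ∑ x, f x ^ 2 :=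
      Real.sq_sqrt (mul_nonneg (inv_nonneg.2 hvol.le) hF)
    have h4 : exp (4 * d * κ) = exp (2 * d * κ) ^ 2 := by rw [sq, ← exp_add]; ring_nf
    rw [hM, mul_pow, mul_pow, mul_pow, mul_pow, hroot, h4]
    field_simp
  have h4' : exp (4 * d * κ') = exp (2 * d * κ') * exp (2 * d * κ') := by rw [← exp_add]; ring_nf
  calc (m'⁻¹) ^ 2 * ((((n : ℝ) + 1) ^ d * (c₁ * M * Kδ) ^ 2) * exp (2 * d * κ') * K2) * exp (2 * d * κ')
        * exp (-(2 * κ' * ∑ i, (((y i - y₀ i).valMinAbs.natAbs : ℕ) : ℝ)))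
      = (m'⁻¹) ^ 2 * (((n : ℝ) + 1) ^ d * (c₁ * M * Kδ) ^ 2) * (exp (2 * d * κ') * exp (2 * d * κ')) * K2
        * exp (-(2 * κ' * ∑ i, (((y i - y₀ i).valMinAbs.natAbs : ℕ) : ℝ))) := by ring
    _ = _ := by rw [hM2, ← h4']; ring

include ha hκ0 hκ1 hκγ hε hm hκ'0 hκ'1 hκ'γ hm' hδ hδ₁ h2δ h2κ' hc₁ hV hK hψ hMinv hf hu in
/-- **THE FLUCTUATION PART `u − h` IS EXPONENTIALLY LOCAL IN BLOCK `ℓ²`, MESH-FREE**: for every block `y`, `Σ_z (u − h)(σ(chart (wm y) z))² ≤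
2·((m_κ − εK_{γ−κ})⁻²e^{4dκ} + (m_{κ′} − εK_{γ−κ′})⁻²(m_κ − εK_{γ−κ})⁻²c₁²e^{4dκ}e^{4dκ′}K_δ²K_{2κ′})·e^{−2κ′ρ_s(y,y₀)}·Σ_x f x²` ((164) + §2). [folklore] -/
theorem perturbed_fluctuation_blockSq_le (y : Site d s) :
    ∑ z : Fin d → Fin (n + 1), (u (siteOf d ((n + 1) * s) (chart n (windowMap d s y) z)) - ∑ y', (∑ y'', Minv y' y''
        * ((((n : ℝ) + 1) ^ d)⁻¹ * ∑ z'' : Fin d → Fin (n + 1), u (siteOf d ((n + 1) * s) (chart n (windowMap d s y'') z''))))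
        * ψ y' (siteOf d ((n + 1) * s) (chart n (windowMap d s y) z))) ^ 2
      ≤ 2 * (((min 2 a - lam - 2 * d * κ ^ 2 - a * (exp (2 * d * κ) - 1) - ε * (2 * (1 - exp (-(γ - κ)))⁻¹) ^ d)⁻¹) ^ 2
            * exp (4 * d * κ)
          + ((min 2 a - lam - 2 * d * κ' ^ 2 - a * (exp (2 * d * κ') - 1) - ε * (2 * (1 - exp (-(γ - κ')))⁻¹) ^ d)⁻¹) ^ 2
            * ((min 2 a - lam - 2 * d * κ ^ 2 - a * (exp (2 * d * κ) - 1) - ε * (2 * (1 - exp (-(γ - κ)))⁻¹) ^ d)⁻¹) ^ 2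
            * c₁ ^ 2 * exp (4 * d * κ) * exp (4 * d * κ') * ((2 * (1 - exp (-δ))⁻¹) ^ d) ^ 2 * (2 * (1 - exp (-(2 * κ')))⁻¹) ^ d)
        * exp (-(2 * κ' * ∑ i, (((y i - y₀ i).valMinAbs.natAbs : ℕ) : ℝ))) * ∑ x, f x ^ 2 := by
  classical
  set h : Site d ((n + 1) * s) → ℝ := fun x => ∑ y', (∑ y'', Minv y' y''
    * ((((n : ℝ) + 1) ^ d)⁻¹ * ∑ z'' : Fin d → Fin (n + 1), u (siteOf d ((n + 1) * s) (chart n (windowMap d s y'') z''))))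
    * ψ y' x with hh_def
  have hu2 := perturbed_blockSq_le_of_block_source n a s ha hκ0 hκ1 hκγ hε hm V hV K hK u f hu y₀ hf y
  have hh2 := perturbed_response_blockSq_le n a s V K ψ hψ Minv u ha hκ0 hκ1 hκγ hε hm hκ'0 hκ'1 hκ'γ hm' hδ hδ₁ h2δ h2κ' hc₁ hV hK
    hMinv y₀ f hf hu y
  change ∑ z : Fin d → Fin (n + 1), h (siteOf d ((n + 1) * s) (chart n (windowMap d s y) z)) ^ 2 ≤ _ at hh2
  have hρ0n : 0 ≤ ∑ i, (((y i - y₀ i).valMinAbs.natAbs : ℕ) : ℝ) := Finset.sum_nonneg fun _ _ => Nat.cast_nonneg _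
  have hκ'κ : κ' ≤ κ := by linarith
  have hexp : exp (-(2 * κ * ∑ i, (((y i - y₀ i).valMinAbs.natAbs : ℕ) : ℝ)))
      ≤ exp (-(2 * κ' * ∑ i, (((y i - y₀ i).valMinAbs.natAbs : ℕ) : ℝ))) :=
    exp_le_exp.2 (by nlinarith [mul_le_mul_of_nonneg_right hκ'κ hρ0n])
  have hF : 0 ≤ ∑ x, f x ^ 2 := Finset.sum_nonneg fun _ _ => sq_nonneg _
  -- `(p − q)² ≤ 2p² + 2q²` termwise
  have hsplit : ∑ z : Fin d → Fin (n + 1), (u (siteOf d ((n + 1) * s) (chart n (windowMap d s y) z))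
        - h (siteOf d ((n + 1) * s) (chart n (windowMap d s y) z))) ^ 2
      ≤ 2 * ∑ z : Fin d → Fin (n + 1), u (siteOf d ((n + 1) * s) (chart n (windowMap d s y) z)) ^ 2
        + 2 * ∑ z : Fin d → Fin (n + 1), h (siteOf d ((n + 1) * s) (chart n (windowMap d s y) z)) ^ 2 := by
    rw [Finset.mul_sum, Finset.mul_sum, ← Finset.sum_add_distrib]
    exact Finset.sum_le_sum fun z _ => by
      nlinarith [sq_nonneg (u (siteOf d ((n + 1) * s) (chart n (windowMap d s y) z))
        + h (siteOf d ((n + 1) * s) (chart n (windowMap d s y) z)))]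
  refine hsplit.trans ?_
  have hA0 : 0 ≤ ((min 2 a - lam - 2 * d * κ ^ 2 - a * (exp (2 * d * κ) - 1) - ε * (2 * (1 - exp (-(γ - κ)))⁻¹) ^ d)⁻¹) ^ 2
      * exp (4 * d * κ) := by positivity
  have hu2' : ∑ z : Fin d → Fin (n + 1), u (siteOf d ((n + 1) * s) (chart n (windowMap d s y) z)) ^ 2
      ≤ ((min 2 a - lam - 2 * d * κ ^ 2 - a * (exp (2 * d * κ) - 1) - ε * (2 * (1 - exp (-(γ - κ)))⁻¹) ^ d)⁻¹) ^ 2 * exp (4 * d * κ)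
        * exp (-(2 * κ' * ∑ i, (((y i - y₀ i).valMinAbs.natAbs : ℕ) : ℝ))) * ∑ x, f x ^ 2 :=
    hu2.trans (mul_le_mul_of_nonneg_right (mul_le_mul_of_nonneg_left hexp hA0) hF)
  linarith [hu2', hh2]

end Fluctuation

/-! ## §3. THE END: the fluctuation covariance of `H + K` is exponentially local in block `ℓ²`, unconditionally on the two-sided class -/

/-- **HEADLINE — THE FLUCTUATION COVARIANCE OF THE PERTURBED ROAD IS EXPONENTIALLY LOCAL BLOCK-TO-BLOCK, UNCONDITIONALLY.**  Fix `d`,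
`a > 0`, `λ < min(2,a)`, `Λ ≥ 0`, a kernel rate `γ > 1` and size `ε ≥ 0` with `εK_{γ−1} ≤ (min(2,a) − λ)∕4`.  THERE ARE `C, δ > 0` (functions
of these only) such that for ALL `n, s`, ALL `−λ ≤ V ≤ Λ`, ALL symmetric kernels `|K(x,z)| ≤ εe^{−γρ_N(x,z)}` with block columns `ψ^K`
(`(H + K)ψ^K_{y′} = 𝟙[bt · = y′]`), every block `y₀` and every `(H + K)u = f` with `f` supported in the block `y₀`: with `T_K⁻¹` Mathlib's
inverse of `Matrix.of T_K` and `h := Σ_{y′}(Σ_{y″}T_K⁻¹(y′,y″)·(n+1)^{−d}Σ_z u(σ(chart (wm y″) z)))·ψ^K_{y′}` (`u − h = C_K f`):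
(i) `Σ_z u(σ(chart (wm y) z))² ≤ C·e^{−2δρ_s(y,y₀)}·Σf²`; (ii) `(n+1)^{−d}Σ_z (u − h)(σ(chart (wm y) z)) = 0`;
(iii) `Σ_z (u − h)(σ(chart (wm y) z))² ≤ C·e^{−2δρ_s(y,y₀)}·Σf²` — for EVERY block `y` ((139) by name: (131) `exists_rate`, (166)
`perturbed_nextScale_hessian_local`, (168) `perturbed_schur_mulVec_injective`, §2). [folklore] -/
theorem perturbed_covariance_local (a : ℝ) (ha : 0 < a) {lam Lam ε γ : ℝ} (hm0 : 0 < min 2 a - lam) (hLam : 0 ≤ Lam)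
    (hε : 0 ≤ ε) (hγ : 1 < γ) (hεs : ε * (2 * (1 - exp (-(γ - 1)))⁻¹) ^ d ≤ (min 2 a - lam) / 4) :
    ∃ C δ : ℝ, 0 < C ∧ 0 < δ ∧ ∀ (n s : ℕ) [NeZero s] (V : Site d ((n + 1) * s) → ℝ), (∀ x, -lam ≤ V x) → (∀ x, V x ≤ Lam) →
      ∀ K : Site d ((n + 1) * s) → Site d ((n + 1) * s) → ℝ, (∀ x z, K x z = K z x) →
      (∀ x z, |K x z| ≤ ε * exp (-(γ * ∑ i, (((x i - z i).valMinAbs.natAbs : ℕ) : ℝ)))) →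
      ∀ ψ : Site d s → Site d ((n + 1) * s) → ℝ,
      (∀ y' x, ((n : ℝ) + 1) ^ 2 * ∑ μ, (2 * ψ y' x - ψ y' (x + siteOf d ((n + 1) * s) (e μ)) - ψ y' (x - siteOf d ((n + 1) * s) (e μ)))
        + a / ((n : ℝ) + 1) ^ d * ∑ q ∈ B n (blk n (windowMap d ((n + 1) * s) x)), ψ y' (siteOf d ((n + 1) * s) q) + V x * ψ y' x
        + ∑ z, K x z * ψ y' z = if siteOf d s (blk n (windowMap d ((n + 1) * s) x)) = y' then 1 else 0) →
      ∀ (y₀ : Site d s) (u f : Site d ((n + 1) * s) → ℝ), (∀ x, siteOf d s (blk n (windowMap d ((n + 1) * s) x)) ≠ y₀ → f x = 0) →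
      (∀ x, ((n : ℝ) + 1) ^ 2 * ∑ μ, (2 * u x - u (x + siteOf d ((n + 1) * s) (e μ)) - u (x - siteOf d ((n + 1) * s) (e μ)))
        + a / ((n : ℝ) + 1) ^ d * ∑ q ∈ B n (blk n (windowMap d ((n + 1) * s) x)), u (siteOf d ((n + 1) * s) q) + V x * u x
        + ∑ z, K x z * u z = f x) →
        (∀ y : Site d s, ∑ z : Fin d → Fin (n + 1), u (siteOf d ((n + 1) * s) (chart n (windowMap d s y) z)) ^ 2
          ≤ C * exp (-(2 * δ * ∑ i, (((y i - y₀ i).valMinAbs.natAbs : ℕ) : ℝ))) * ∑ x, f x ^ 2) ∧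
        (∀ y : Site d s, (((n : ℝ) + 1) ^ d)⁻¹ * ∑ z : Fin d → Fin (n + 1), (u (siteOf d ((n + 1) * s) (chart n (windowMap d s y) z))
          - ∑ y', (∑ y'', (Matrix.of fun yy y'' : Site d s =>
              (((n : ℝ) + 1) ^ d)⁻¹ * ∑ z : Fin d → Fin (n + 1), ψ y'' (siteOf d ((n + 1) * s) (chart n (windowMap d s yy) z)))⁻¹ y' y''
            * ((((n : ℝ) + 1) ^ d)⁻¹ * ∑ z'' : Fin d → Fin (n + 1), u (siteOf d ((n + 1) * s) (chart n (windowMap d s y'') z''))))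
            * ψ y' (siteOf d ((n + 1) * s) (chart n (windowMap d s y) z))) = 0) ∧
        (∀ y : Site d s, ∑ z : Fin d → Fin (n + 1), (u (siteOf d ((n + 1) * s) (chart n (windowMap d s y) z))
          - ∑ y', (∑ y'', (Matrix.of fun yy y'' : Site d s =>
              (((n : ℝ) + 1) ^ d)⁻¹ * ∑ z : Fin d → Fin (n + 1), ψ y'' (siteOf d ((n + 1) * s) (chart n (windowMap d s yy) z)))⁻¹ y' y''
            * ((((n : ℝ) + 1) ^ d)⁻¹ * ∑ z'' : Fin d → Fin (n + 1), u (siteOf d ((n + 1) * s) (chart n (windowMap d s y'') z''))))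
            * ψ y' (siteOf d ((n + 1) * s) (chart n (windowMap d s y) z))) ^ 2
          ≤ C * exp (-(2 * δ * ∑ i, (((y i - y₀ i).valMinAbs.natAbs : ℕ) : ℝ))) * ∑ x, f x ^ 2) := by
  classical
  have hd : (0 : ℝ) ≤ d := Nat.cast_nonneg d
  -- the rates: `κ₀` from (131), `(c₁, δ₁)` from (166), `δ = min(δ₁, κ₀∕2)`, `κ′ = δ∕2`
  obtain ⟨κ₀, hκ₀0, hκ₀1, hκ₀m⟩ := exists_rate (d := d) a ha.le hm0
  obtain ⟨c₁, δ₁, hc₁, hδ₁, H166⟩ := perturbed_nextScale_hessian_local (d := d) a ha hm0 hLam hε hγ hεs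
  have hκ₀γ : κ₀ < γ := lt_of_le_of_lt hκ₀1 hγ
  set δ : ℝ := min δ₁ (κ₀ / 2) with hδ_def
  have hδ0 : 0 < δ := lt_min hδ₁ (by linarith)
  have hδδ₁ : δ ≤ δ₁ := min_le_left _ _
  have h2δ : 2 * δ ≤ κ₀ := by have := min_le_right δ₁ (κ₀ / 2); rw [← hδ_def] at this; linarith
  set κ' : ℝ := δ / 2 with hκ'_def
  have hκ'0 : 0 < κ' := by rw [hκ'_def]; linarith
  have h2κ' : 2 * κ' ≤ δ := by rw [hκ'_def]; linarith
  have hκ'κ₀ : κ' ≤ κ₀ := by linarith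
  have hκ'1 : κ' ≤ 1 := hκ'κ₀.trans hκ₀1
  have hκ'γ : κ' < γ := lt_of_le_of_lt hκ'1 hγ
  have hmκ'le : (min 2 a - lam) / 2 ≤ min 2 a - lam - 2 * d * κ' ^ 2 - a * (exp (2 * d * κ') - 1) :=
    hκ₀m.trans (rate_mono (d := d) a ha.le hκ'0.le hκ'κ₀)
  -- the kernel sums at the rates `γ − κ₀`, `γ − κ′`, `γ` are at most `K_{γ−1}`
  have hr0 : ε * (2 * (1 - exp (-(γ - κ₀)))⁻¹) ^ d ≤ (min 2 a - lam) / 4 :=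
    (mul_le_mul_of_nonneg_left (kernelSum_anti (d := d) (by linarith) (by linarith)) hε).trans hεs
  have hr1 : ε * (2 * (1 - exp (-(γ - κ')))⁻¹) ^ d ≤ (min 2 a - lam) / 4 :=
    (mul_le_mul_of_nonneg_left (kernelSum_anti (d := d) (by linarith) (by linarith)) hε).trans hεs
  have hr2 : ε * (2 * (1 - exp (-γ))⁻¹) ^ d ≤ (min 2 a - lam) / 4 :=
    (mul_le_mul_of_nonneg_left (kernelSum_anti (d := d) (by linarith) (by linarith)) hε).trans hεs
  have hmκ₀ : ε * (2 * (1 - exp (-(γ - κ₀)))⁻¹) ^ d < min 2 a - lam - 2 * d * κ₀ ^ 2 - a * (exp (2 * d * κ₀) - 1) := by linarith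
  have hmκ' : ε * (2 * (1 - exp (-(γ - κ')))⁻¹) ^ d < min 2 a - lam - 2 * d * κ' ^ 2 - a * (exp (2 * d * κ') - 1) := by linarith
  have hlam : lam + ε * (2 * (1 - exp (-γ))⁻¹) ^ d ≤ min 2 a := by linarith
  set Kδ : ℝ := (2 * (1 - exp (-δ))⁻¹) ^ d with hKδ
  have hKδ0 : 0 ≤ Kδ := pow_nonneg (mul_nonneg zero_le_two (inv_nonneg.2 (sub_nonneg.2 (exp_le_one_iff.2 (by linarith))))) d
  set K2 : ℝ := (2 * (1 - exp (-(2 * κ')))⁻¹) ^ d with hK2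
  have hK20 : 0 ≤ K2 := pow_nonneg (mul_nonneg zero_le_two (inv_nonneg.2 (sub_nonneg.2 (exp_le_one_iff.2 (by linarith))))) d
  set A : ℝ := ((min 2 a - lam - 2 * d * κ₀ ^ 2 - a * (exp (2 * d * κ₀) - 1) - ε * (2 * (1 - exp (-(γ - κ₀)))⁻¹) ^ d)⁻¹) ^ 2
    * exp (4 * d * κ₀) with hA
  set Bc : ℝ := ((min 2 a - lam - 2 * d * κ' ^ 2 - a * (exp (2 * d * κ') - 1) - ε * (2 * (1 - exp (-(γ - κ')))⁻¹) ^ d)⁻¹) ^ 2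
    * ((min 2 a - lam - 2 * d * κ₀ ^ 2 - a * (exp (2 * d * κ₀) - 1) - ε * (2 * (1 - exp (-(γ - κ₀)))⁻¹) ^ d)⁻¹) ^ 2
    * c₁ ^ 2 * exp (4 * d * κ₀) * exp (4 * d * κ') * Kδ ^ 2 * K2 with hBc
  have hA0 : 0 ≤ A := by positivity
  have hBc0 : 0 ≤ Bc := by positivity
  -- the constant: twice the sum of the two lemmas' constants, plus one
  refine ⟨2 * (A + Bc) + 1, κ', by positivity, hκ'0, ?_⟩
  intro n s _ V hV hV' K hKs hK ψ hψ y₀ u f hf hu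
  set T : Matrix (Site d s) (Site d s) ℝ := Matrix.of fun yy y'' : Site d s =>
    (((n : ℝ) + 1) ^ d)⁻¹ * ∑ z : Fin d → Fin (n + 1), ψ y'' (siteOf d ((n + 1) * s) (chart n (windowMap d s yy) z)) with hT_def
  have hF : 0 ≤ ∑ x, f x ^ 2 := Finset.sum_nonneg fun _ _ => sq_nonneg _
  -- invertibility of `T_K` and the right-inverse display
  have hunit : IsUnit T.det := (Matrix.isUnit_iff_isUnit_det _).1
    (Matrix.mulVec_injective_iff_isUnit.1 (perturbed_schur_mulVec_injective n a s ha hLam hε (by linarith) hlam V hV hV' K hKs hK ψ hψ))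
  have hTM : ∀ y y'' : Site d s, ∑ y', ((((n : ℝ) + 1) ^ d)⁻¹
        * ∑ z : Fin d → Fin (n + 1), ψ y' (siteOf d ((n + 1) * s) (chart n (windowMap d s y) z))) * T⁻¹ y' y''
      = if y = y'' then 1 else 0 := by
    intro y y''
    have h1 : (T * T⁻¹) y y'' = if y = y'' then 1 else 0 := by rw [Matrix.mul_nonsing_inv T hunit, Matrix.one_apply]
    rw [Matrix.mul_apply] at h1
    simpa only [hT_def, Matrix.of_apply] using h1
  have hMinv : ∀ y' y'' : Site d s, |T⁻¹ y' y''| ≤ c₁ * exp (-(δ₁ * ∑ i, (((y' i - y'' i).valMinAbs.natAbs : ℕ) : ℝ))) :=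
    fun y' y'' => H166 n s V hV hV' K hKs hK ψ hψ y' y''
  refine ⟨fun y => ?_, fun y => ?_, fun y => ?_⟩
  · -- (i) the unconstrained propagator `(H + K)⁻¹`
    have hu2 := perturbed_blockSq_le_of_block_source n a s ha.le hκ₀0.le hκ₀1 hκ₀γ hε hmκ₀ V hV K hK u f hu y₀ hf y
    have hρ0n : 0 ≤ ∑ i, (((y i - y₀ i).valMinAbs.natAbs : ℕ) : ℝ) := Finset.sum_nonneg fun _ _ => Nat.cast_nonneg _
    have hexp : exp (-(2 * κ₀ * ∑ i, (((y i - y₀ i).valMinAbs.natAbs : ℕ) : ℝ)))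
        ≤ exp (-(2 * κ' * ∑ i, (((y i - y₀ i).valMinAbs.natAbs : ℕ) : ℝ))) :=
      exp_le_exp.2 (by nlinarith [mul_le_mul_of_nonneg_right hκ'κ₀ hρ0n])
    refine hu2.trans ?_
    have hE0 : 0 ≤ exp (-(2 * κ' * ∑ i, (((y i - y₀ i).valMinAbs.natAbs : ℕ) : ℝ))) := (exp_pos _).le
    have hc1 : A ≤ 2 * (A + Bc) + 1 := by linarith
    calc A * exp (-(2 * κ₀ * ∑ i, (((y i - y₀ i).valMinAbs.natAbs : ℕ) : ℝ))) * ∑ x, f x ^ 2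
        ≤ A * exp (-(2 * κ' * ∑ i, (((y i - y₀ i).valMinAbs.natAbs : ℕ) : ℝ))) * ∑ x, f x ^ 2 :=
          mul_le_mul_of_nonneg_right (mul_le_mul_of_nonneg_left hexp hA0) hF
      _ ≤ _ := mul_le_mul_of_nonneg_right (mul_le_mul_of_nonneg_right hc1 hE0) hF
  · -- (ii) zero block means of the fluctuation part
    rw [Finset.sum_sub_distrib, mul_sub, sub_eq_zero]
    exact (blockMean_response_eq n s ψ (fun y' y'' => T⁻¹ y' y'') u hTM y).symm
  · -- (iii) the fluctuation covariance
    have h := perturbed_fluctuation_blockSq_le n a s V K ψ hψ (fun y' y'' => T⁻¹ y' y'') u ha.le hκ₀0.le hκ₀1 hκ₀γ hε hmκ₀ hκ'0 hκ'1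
      hκ'γ hmκ' hδ0 hδδ₁ h2δ h2κ' hc₁.le hV hK hMinv y₀ f hf hu y
    refine h.trans ?_
    have hE0 : 0 ≤ exp (-(2 * κ' * ∑ i, (((y i - y₀ i).valMinAbs.natAbs : ℕ) : ℝ))) := (exp_pos _).le
    exact mul_le_mul_of_nonneg_right (mul_le_mul_of_nonneg_right (by linarith) hE0) hF

/-! ## §4. Toy -/

/-- Toy (`d = 0`, `a = 1`, `λ = 0`, `Λ = 1`, `γ = 2`, `ε = 0`): the constants of the perturbed covariance letter exist. -/
example : ∃ C δ : ℝ, 0 < C ∧ 0 < δ :=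
  let ⟨C, δ, hC, hδ, _⟩ := perturbed_covariance_local (d := 0) 1 one_pos (lam := 0) (Lam := 1) (ε := 0) (γ := 2)
    (by norm_num) zero_le_one le_rfl (by norm_num) (by norm_num)
  ⟨C, δ, hC, hδ⟩

end Summit.QuantumFields.BalabanUV.T4Continuum.NE7b.SupTorusPerturbedCovariance
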